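import Mathlib.Combinatorics.SetFamily.Compression.Down
import Summits.CriticalPhenomena.PercolationContinuityZ3.Theorems.PercNearOneGluingNoHeavyLowerTailNineTypeCellCount

/-!
# Compression (order-shattering) certificates for the nine-type count, and `Q44b ∀n` from them

Support file for crux `stmt-CriticalPhenomena-4575` (master-family programme; quadratic four-point row `Q44b`,
OPEN for all `n`), seat `prim-l12-p1` gen 9; memo `run/shared/lean/prim/prim-l12/FROM-prim-l12-p1-g9-COMPRESSION-GAME.md`.

By `TwoCopyMono.goodKernel_kerS_iff_cellCount` / `Q44b.row_nonneg_of_cellCount` (`prim-l12-p6` gen 11) the whole of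
`Q44b ∀n` is ONE counting statement: for every monotone map `ι` from the subsets of a finite type `γ` to the 15
four-point cells, the bad points (subsets `T` with `(ι T, ι Tᶜ)` one of the nine (heavy, light) type pairs) are at most
as many as the goods (`ι T ∈ AC`, `ι Tᶜ = ⊥`).  `prim-bnk-1` gen 18 §15 proposed to prove the count by ORDER-SHATTERING
(Anstee–Rónyai–Sali): choose for every bad point `T` one of `T`, `Tᶜ` (a "sign"), and a linear order of the
coordinates; if the order-shattered sets of the chosen family are all complements of goods, the count follows.  This
file records the route in the equivalent and formally lighter language of ITERATED DOWN-COMPRESSION (Kleitman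
shifting; Mathlib's `Down.compression`): the reverse-lexicographic order-shattered family of `𝒜` IS the iterated
down-compression of `𝒜` (smallest coordinate first), and each compression step is a bijection, so

  `iterDown l 𝒜 ⊆ ℬ  ⟹  #𝒜 ≤ #ℬ`           (`Compression.card_le_card_of_iterDown_subset`),

with no hypothesis on the list `l` (repetitions and omissions allowed).  We also give the strictly more flexible
DECISION-TREE form (`Compression.treeDown`: the coordinate compressed last at a node may differ between the two halves),
which is again cardinality preserving when no coordinate is reused below itself (`Compression.card_treeDown`); in the
game reading, `S ∉ treeDown t 𝒜ᶜᶜ…` — see the memo: `Sᶜ` survives iff the `∃∀`-player owning the coordinates of `S`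
can force the revealed set into the family, coordinates being revealed from the root down.

Main results (pure finite combinatorics; no named facts, no sorries):
* `Compression.card_iterDown`, `Compression.card_le_card_of_iterDown_subset`, `Compression.exists_superset_of_mem_iterDown`
  (every compressed member sits inside an original member — so a certificate also yields a system of distinct
  SUB-representatives, the Marica–Schönheim shape studied by `prim-l12-p6` gen 9);
* `Compression.card_treeDown` (under `CTree.Avoids`), `Compression.card_le_card_of_treeDown_subset`;
* `TwoCopyMono.transpose_table` (no type pair is the transpose of another: a bad point's complement is never bad),
  `TwoCopyMono.deltaRep_injOn`;
* `TwoCopyMono.cellCount_of_listCert` / `cellCount_of_treeCert`: a compression certificate for a cell map gives the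
  nine-type count for that map (monotonicity of `ι` is not even used here — it is what makes certificates EXIST);
* `Q44b.row_nonneg_of_listCerts` / `Q44b.row_nonneg_of_treeCerts`: **`Q44b ∀n` ⟸ every monotone cell map has a
  compression certificate** — the conjecture `T1` of `prim-bnk-1` g18 §15, checked here (gen 9) on all 70,807,209
  monotone maps of `B_4`, every graph fibre on ≤ 7 vertices with ≤ 7 edges (103,277 instances) and > 10⁵ dense random
  monotone maps on `B_5 … B_7`, always with one of only TWO sign systems (heavy / a-oriented, memo §3).
-/

namespace Summit.CriticalPhenomena.PercolationContinuityZ3.Theorems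

/-! ## Iterated down-compression along a list and along a decision tree -/

namespace Compression

open Finset

variable {α : Type*} [DecidableEq α]

/-- Iterated down-compression of a set family along a list of coordinates, head compressed FIRST
(so the head is the innermost / last-queried coordinate of the game, the last entry the outermost). [this work] -/
def iterDown : List α → Finset (Finset α) → Finset (Finset α)
  | [], 𝒜 => 𝒜
  | a :: l, 𝒜 => iterDown l (Down.compression a 𝒜)

/-- Unfolding `iterDown` on the empty list. [this work] -/
@[simp] theorem iterDown_nil (𝒜 : Finset (Finset α)) : iterDown [] 𝒜 = 𝒜 := rfl

/-- Unfolding `iterDown` on a cons. [this work] -/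
@[simp] theorem iterDown_cons (a : α) (l : List α) (𝒜 : Finset (Finset α)) :
    iterDown (a :: l) 𝒜 = iterDown l (Down.compression a 𝒜) := rfl

/-- Iterated down-compression preserves the number of members (each step is a bijection, Mathlib's
`Down.card_compression`). [this work] -/
theorem card_iterDown (l : List α) (𝒜 : Finset (Finset α)) : #(iterDown l 𝒜) = #𝒜 := by
  induction l generalizing 𝒜 with
  | nil => rfl
  | cons a l ih => rw [iterDown_cons, ih, Down.card_compression]

/-- **Counting by compression.** If the iterated down-compression of `𝒜` lies inside `ℬ` then `#𝒜 ≤ #ℬ`. [this work] -/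
theorem card_le_card_of_iterDown_subset {l : List α} {𝒜 ℬ : Finset (Finset α)} (h : iterDown l 𝒜 ⊆ ℬ) :
    #𝒜 ≤ #ℬ := by
  rw [← card_iterDown l 𝒜]
  exact card_le_card h

/-- A member of a one-step down-compression is contained in a member of the original family. [this work] -/
theorem exists_superset_of_mem_compression {a : α} {𝒜 : Finset (Finset α)} {s : Finset α}
    (hs : s ∈ Down.compression a 𝒜) : ∃ t ∈ 𝒜, s ⊆ t := by
  rw [Down.mem_compression] at hs
  rcases hs with ⟨h, -⟩ | ⟨-, h⟩
  · exact ⟨s, h, Subset.rfl⟩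
  · exact ⟨insert a s, h, subset_insert a s⟩

/-- Every member of the iterated down-compression is contained in a member of the original family; with
`card_iterDown` this makes a certificate `iterDown l 𝒜 ⊆ ℬ` an injection `𝒜 ↪ ℬ` along `⊇` composed step by step
(a system of distinct sub-representatives). [this work] -/
theorem exists_superset_of_mem_iterDown (l : List α) {𝒜 : Finset (Finset α)} {s : Finset α}
    (hs : s ∈ iterDown l 𝒜) : ∃ t ∈ 𝒜, s ⊆ t := by
  induction l generalizing 𝒜 with
  | nil => exact ⟨s, hs, Subset.rfl⟩
  | cons a l ih =>
    obtain ⟨t, ht, hst⟩ := ih hs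
    obtain ⟨u, hu, htu⟩ := exists_superset_of_mem_compression ht
    exact ⟨u, hu, hst.trans htu⟩

/-- Down-compression at `a` does not change membership of any other coordinate `x ≠ a`: if every member of `𝒜`
contains `x`, so does every member of the compression. [this work] -/
theorem forall_mem_compression_of_ne {a x : α} (hxa : x ≠ a) {𝒜 : Finset (Finset α)}
    (h : ∀ s ∈ 𝒜, x ∈ s) : ∀ s ∈ Down.compression a 𝒜, x ∈ s := by
  intro s hs
  rw [Down.mem_compression] at hs
  rcases hs with ⟨hs, -⟩ | ⟨-, hs⟩
  · exact h s hs
  · have := h _ hs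
    rcases mem_insert.1 this with rfl | hx
    · exact absurd rfl hxa
    · exact hx

/-- Companion of `forall_mem_compression_of_ne`: if no member of `𝒜` contains `x ≠ a`, neither does any member of
the compression at `a`. [this work] -/
theorem forall_not_mem_compression_of_ne {a x : α} (_hxa : x ≠ a) {𝒜 : Finset (Finset α)}
    (h : ∀ s ∈ 𝒜, x ∉ s) : ∀ s ∈ Down.compression a 𝒜, x ∉ s := by
  intro s hs
  rw [Down.mem_compression] at hs
  rcases hs with ⟨hs, -⟩ | ⟨-, hs⟩
  · exact h s hs
  · exact fun hx => h _ hs (mem_insert_of_mem hx)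

/-- Binary decision trees of coordinates: `node a hb lb` queries `a` first (outermost) and continues with `hb` on
the members containing `a` and with `lb` on the others. [this work] -/
inductive CTree (α : Type*) where
  | nil : CTree α
  | node : α → CTree α → CTree α → CTree α

/-- Tree (adaptive) down-compression: compress the two halves along their own subtrees, then compress at the root
coordinate.  For `node a t t` with a list-shaped `t` this is `iterDown` of the reversed list. [this work] -/
def treeDown : CTree α → Finset (Finset α) → Finset (Finset α)
  | .nil, 𝒜 => 𝒜
  | .node a hb lb, 𝒜 =>
      Down.compression a (treeDown hb (𝒜.filter fun s => a ∈ s) ∪ treeDown lb (𝒜.filter fun s => a ∉ s))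

/-- Well-formedness of a decision tree relative to a set `F` of forbidden coordinates: no node uses a forbidden
coordinate, and a coordinate is forbidden below the node that uses it (no coordinate is queried twice on a
root-to-leaf path). [this work] -/
def CTree.Avoids : CTree α → Finset α → Prop
  | .nil, _ => True
  | .node a hb lb, F => a ∉ F ∧ hb.Avoids (insert a F) ∧ lb.Avoids (insert a F)

/-- A well-formed tree never touches a forbidden coordinate: membership of `x ∈ F` in every member is preserved. [this work] -/
theorem forall_mem_treeDown {t : CTree α} {F : Finset α} (ht : t.Avoids F) {x : α} (hx : x ∈ F)
    {𝒜 : Finset (Finset α)} (h : ∀ s ∈ 𝒜, x ∈ s) : ∀ s ∈ treeDown t 𝒜, x ∈ s := by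
  induction t generalizing F 𝒜 with
  | nil => exact h
  | node a hb lb ihhi ihlo =>
    obtain ⟨haF, hhi, hlo⟩ := ht
    have hxa : x ≠ a := fun hxa => haF (hxa ▸ hx)
    have hx' : x ∈ insert a F := mem_insert_of_mem hx
    refine forall_mem_compression_of_ne hxa fun s hs => ?_
    rcases mem_union.1 hs with hs | hs
    · exact ihhi hhi hx' (fun u hu => h u (mem_filter.1 hu).1) s hs
    · exact ihlo hlo hx' (fun u hu => h u (mem_filter.1 hu).1) s hs

/-- A well-formed tree never touches a forbidden coordinate: non-membership of `x ∈ F` is preserved. [this work] -/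
theorem forall_not_mem_treeDown {t : CTree α} {F : Finset α} (ht : t.Avoids F) {x : α} (hx : x ∈ F)
    {𝒜 : Finset (Finset α)} (h : ∀ s ∈ 𝒜, x ∉ s) : ∀ s ∈ treeDown t 𝒜, x ∉ s := by
  induction t generalizing F 𝒜 with
  | nil => exact h
  | node a hb lb ihhi ihlo =>
    obtain ⟨haF, hhi, hlo⟩ := ht
    have hxa : x ≠ a := fun hxa => haF (hxa ▸ hx)
    have hx' : x ∈ insert a F := mem_insert_of_mem hx
    refine forall_not_mem_compression_of_ne hxa fun s hs => ?_
    rcases mem_union.1 hs with hs | hs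
    · exact ihhi hhi hx' (fun u hu => h u (mem_filter.1 hu).1) s hs
    · exact ihlo hlo hx' (fun u hu => h u (mem_filter.1 hu).1) s hs

/-- **Tree compression preserves the number of members** (for well-formed trees). [this work] -/
theorem card_treeDown {t : CTree α} {F : Finset α} (ht : t.Avoids F) (𝒜 : Finset (Finset α)) :
    #(treeDown t 𝒜) = #𝒜 := by
  induction t generalizing F 𝒜 with
  | nil => rfl
  | node a hb lb ihhi ihlo =>
    obtain ⟨-, hhi, hlo⟩ := ht
    have ha : a ∈ insert a F := mem_insert_self a F
    show #(Down.compression a (treeDown hb (𝒜.filter fun s => a ∈ s) ∪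
      treeDown lb (𝒜.filter fun s => a ∉ s))) = #𝒜
    rw [Down.card_compression, card_union_of_disjoint, ihhi hhi, ihlo hlo,
      card_filter_add_card_filter_not]
    rw [disjoint_left]
    intro s hs1 hs0
    exact forall_not_mem_treeDown hlo ha (fun u hu => (mem_filter.1 hu).2) s hs0
      (forall_mem_treeDown hhi ha (fun u hu => (mem_filter.1 hu).2) s hs1)

/-- **Counting by tree compression.** [this work] -/
theorem card_le_card_of_treeDown_subset {t : CTree α} (ht : t.Avoids ∅) {𝒜 ℬ : Finset (Finset α)}
    (h : treeDown t 𝒜 ⊆ ℬ) : #𝒜 ≤ #ℬ := by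
  rw [← card_treeDown ht 𝒜]
  exact card_le_card h

end Compression

/-! ## Certificates for monotone cell maps -/

namespace TwoCopyMono

open Finset

/-- Table fact: no nine-type pair is the transpose of another — if `(ι T, ι Tᶜ)` is a (heavy, light) pair then
`(ι Tᶜ, ι T)` is not; so the complement of a bad point is never a bad point. [this work] -/
theorem transpose_table : ∀ θ ∈ (Finset.Icc 1 9 : Finset ℕ), ∀ θ' ∈ (Finset.Icc 1 9 : Finset ℕ),
    ¬ (hIdx θ = lIdx θ' ∧ lIdx θ = hIdx θ') := by
  decide

variable {γ : Type*} [Fintype γ] [DecidableEq γ]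

/-- The Δ-side representative of a point under a sign choice `σ`: `T` itself when `σ T` (the point is "L-signed":
its own set is kept on the complement side), `Tᶜ` otherwise ("H-signed"). [this work] -/
def deltaRep (σ : Finset γ → Bool) (T : Finset γ) : Finset γ := if σ T then T else Tᶜ

/-- `deltaRep σ` is injective on the bad points of a cell map (types from `S ⊆ {1,…,9}`): two bad points with the
same representative would be complementary, contradicting `transpose_table`. [this work] -/
theorem deltaRep_injOn {S : Finset ℕ} (hS : S ⊆ Finset.Icc 1 9) (ι : Finset γ → Fin 15) (σ : Finset γ → Bool) :
    Set.InjOn (deltaRep σ) ↑(Finset.univ.filter fun T : Finset γ => badS S (ι T) (ι Tᶜ)) := by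
  intro T hT T' hT' heq
  rw [coe_filter] at hT hT'
  have hT : badS S (ι T) (ι Tᶜ) := hT.2
  have hT' : badS S (ι T') (ι T'ᶜ) := hT'.2
  -- complementary bad points are impossible
  have key : T' ≠ Tᶜ := by
    rintro rfl
    obtain ⟨θ, hθ, h1, h2⟩ := hT
    obtain ⟨θ', hθ', h1', h2'⟩ := hT'
    rw [compl_compl] at h2'
    exact transpose_table θ (hS hθ) θ' (hS hθ') ⟨h1.trans h2'.symm, h2.trans h1'.symm⟩
  unfold deltaRep at heq
  by_cases h1 : σ T = true <;> by_cases h2 : σ T' = true <;> simp only [h1, h2] at heq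
  · exact heq
  · simp only [Bool.false_eq_true, ↓reduceIte, ↓reduceIte] at heq
    exact absurd (by rw [heq, compl_compl]) key
  · simp only [Bool.false_eq_true, ↓reduceIte] at heq
    exact absurd heq.symm key
  · simp only [Bool.false_eq_true, ↓reduceIte] at heq
    exact compl_injective heq

/-- A LIST COMPRESSION CERTIFICATE for the cell map `ι` (types from `S`): signs `σ` and a coordinate list `l` such
that the iterated down-compression of the Δ-representatives of the bad points consists of complements of goods
(= bnk-1's `osh_<(ℱ_c) ⊆ Δ`). [this work] -/
def ListCert (S : Finset ℕ) (ι : Finset γ → Fin 15) (σ : Finset γ → Bool) (l : List γ) : Prop :=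
  Compression.iterDown l ((Finset.univ.filter fun T : Finset γ => badS S (ι T) (ι Tᶜ)).image (deltaRep σ)) ⊆
    (Finset.univ.filter fun T : Finset γ => isAC (ι T) ∧ ι Tᶜ = 0).image compl

/-- A TREE COMPRESSION CERTIFICATE: as `ListCert` with an adaptive (decision-tree) order. [this work] -/
def TreeCert (S : Finset ℕ) (ι : Finset γ → Fin 15) (σ : Finset γ → Bool) (t : Compression.CTree γ) : Prop :=
  t.Avoids ∅ ∧
    Compression.treeDown t ((Finset.univ.filter fun T : Finset γ => badS S (ι T) (ι Tᶜ)).image (deltaRep σ)) ⊆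
      (Finset.univ.filter fun T : Finset γ => isAC (ι T) ∧ ι Tᶜ = 0).image compl

/-- **A list certificate gives the count** `#bad ≤ #good` for that cell map. [this work] -/
theorem cellCount_of_listCert {S : Finset ℕ} (hS : S ⊆ Finset.Icc 1 9) (ι : Finset γ → Fin 15)
    {σ : Finset γ → Bool} {l : List γ} (h : ListCert S ι σ l) :
    #(Finset.univ.filter fun T : Finset γ => badS S (ι T) (ι Tᶜ)) ≤
      #(Finset.univ.filter fun T : Finset γ => isAC (ι T) ∧ ι Tᶜ = 0) := by
  rw [← card_image_of_injOn (deltaRep_injOn hS ι σ)]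
  refine (Compression.card_le_card_of_iterDown_subset h).trans ?_
  rw [card_image_of_injective _ compl_injective]

/-- **A tree certificate gives the count** `#bad ≤ #good` for that cell map. [this work] -/
theorem cellCount_of_treeCert {S : Finset ℕ} (hS : S ⊆ Finset.Icc 1 9) (ι : Finset γ → Fin 15)
    {σ : Finset γ → Bool} {t : Compression.CTree γ} (h : TreeCert S ι σ t) :
    #(Finset.univ.filter fun T : Finset γ => badS S (ι T) (ι Tᶜ)) ≤
      #(Finset.univ.filter fun T : Finset γ => isAC (ι T) ∧ ι Tᶜ = 0) := by
  rw [← card_image_of_injOn (deltaRep_injOn hS ι σ)]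
  refine (Compression.card_le_card_of_treeDown_subset h.1 h.2).trans ?_
  rw [card_image_of_injective _ compl_injective]

end TwoCopyMono

/-! ## `Q44b ∀n` from compression certificates -/

namespace Q44b

/-- **`Q44b ∀n` ⟸ every monotone four-point cell map has a LIST compression certificate** (conjecture `T1` of
`prim-bnk-1` g18 §15 in compression form; 0 exceptions in the gen-9 census, memo §2). [this work] -/
theorem row_nonneg_of_listCerts
    (h : ∀ (γ : Type) [Fintype γ] [DecidableEq γ] (ι : Finset γ → Fin 15),
      (∀ A B : Finset γ, A ⊆ B → TwoCopyMono.ple (ι A) (ι B) = true) →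
        ∃ (σ : Finset γ → Bool) (l : List γ), TwoCopyMono.ListCert (Finset.Icc 1 9 : Finset ℕ) ι σ l)
    {n : ℕ} (w : Sym2 (Fin n) → unitInterval) (a b c y : Fin n) : 0 ≤ row w a b c y := by
  refine row_nonneg_of_cellCount (fun γ _ _ ι hmono => ?_) w a b c y
  obtain ⟨σ, l, hc⟩ := h γ ι hmono
  exact TwoCopyMono.cellCount_of_listCert subset_rfl ι hc

/-- **`Q44b ∀n` ⟸ every monotone four-point cell map has a TREE compression certificate** (the adaptive form; trees
are strictly more powerful for a FIXED sign system, memo §3). [this work] -/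
theorem row_nonneg_of_treeCerts
    (h : ∀ (γ : Type) [Fintype γ] [DecidableEq γ] (ι : Finset γ → Fin 15),
      (∀ A B : Finset γ, A ⊆ B → TwoCopyMono.ple (ι A) (ι B) = true) →
        ∃ (σ : Finset γ → Bool) (t : Compression.CTree γ), TwoCopyMono.TreeCert (Finset.Icc 1 9 : Finset ℕ) ι σ t)
    {n : ℕ} (w : Sym2 (Fin n) → unitInterval) (a b c y : Fin n) : 0 ≤ row w a b c y := by
  refine row_nonneg_of_cellCount (fun γ _ _ ι hmono => ?_) w a b c y
  obtain ⟨σ, t, hc⟩ := h γ ι hmono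
  exact TwoCopyMono.cellCount_of_treeCert subset_rfl ι hc

end Q44b

/-! ## Game unfolding (appended, `prim-l12-p1` gen 9)

How to PROVE a certificate: membership in a compressed family unfolds coordinate by coordinate, outermost (last
compressed) coordinate first.  Reading a set `s` of the Δ-side as the complement of the ∃-player's coordinate set,
`Compression.mem_compression_iff_ite` / `mem_iterDown_concat` / `mem_treeDown_node` say: a set CONTAINING the
outermost coordinate `a` survives iff BOTH `s` and `s.erase a` survive one level down (the ∀-player owns `a`), a set
AVOIDING `a` survives iff `s` OR `insert a s` survives (the ∃-player owns `a`).  So `U ⊆ Δ` ("every surviving set is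
the complement of a good") is proved by exhibiting, for every complement of a non-good, a strategy of the ∀-player.
-/

namespace Compression

open Finset

variable {α : Type*} [DecidableEq α]

/-- One down-compression step as a two-player move: a set containing `a` survives iff it and its `a`-erasure are
both in the family; a set avoiding `a` survives iff it or its `a`-insertion is in the family. [this work] -/
theorem mem_compression_iff_ite (a : α) (𝒳 : Finset (Finset α)) (s : Finset α) :
    s ∈ Down.compression a 𝒳 ↔
      if a ∈ s then s ∈ 𝒳 ∧ s.erase a ∈ 𝒳 else s ∈ 𝒳 ∨ insert a s ∈ 𝒳 := by
  rw [Down.mem_compression]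
  split_ifs with ha
  · constructor
    · rintro (h | ⟨hs, hins⟩)
      · exact h
      · rw [insert_eq_of_mem ha] at hins
        exact absurd hins hs
    · exact fun h => Or.inl h
  · rw [erase_eq_of_notMem ha]
    constructor
    · rintro (⟨h, -⟩ | ⟨-, h⟩)
      · exact Or.inl h
      · exact Or.inr h
    · rintro (h | h)
      · exact Or.inl ⟨h, h⟩
      · by_cases hs : s ∈ 𝒳
        · exact Or.inl ⟨hs, hs⟩
        · exact Or.inr ⟨hs, h⟩

/-- The last coordinate of the list is compressed last (it is the OUTERMOST coordinate of the game). [this work] -/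
theorem iterDown_concat (l : List α) (a : α) (𝒜 : Finset (Finset α)) :
    iterDown (l ++ [a]) 𝒜 = Down.compression a (iterDown l 𝒜) := by
  induction l generalizing 𝒜 with
  | nil => rfl
  | cons b l ih => rw [List.cons_append, iterDown_cons, iterDown_cons, ih]

/-- **Game unfolding for list certificates** at the outermost coordinate. [this work] -/
theorem mem_iterDown_concat (l : List α) (a : α) (𝒜 : Finset (Finset α)) (s : Finset α) :
    s ∈ iterDown (l ++ [a]) 𝒜 ↔
      if a ∈ s then s ∈ iterDown l 𝒜 ∧ s.erase a ∈ iterDown l 𝒜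
      else s ∈ iterDown l 𝒜 ∨ insert a s ∈ iterDown l 𝒜 := by
  rw [iterDown_concat, mem_compression_iff_ite]

/-- **Game unfolding for tree certificates** at the root of a well-formed tree: with `A` = the compressed `a`-half
(members containing `a`, along `hb`) and `B` = the compressed `a`-free half (along `lb`), a set containing `a` survives
iff `s ∈ A` and `s.erase a ∈ B`; a set avoiding `a` survives iff `s ∈ B` or `insert a s ∈ A`. [this work] -/
theorem mem_treeDown_node {a : α} {hb lb : CTree α} {F : Finset α} (ht : (CTree.node a hb lb).Avoids F)
    (𝒜 : Finset (Finset α)) (s : Finset α) :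
    s ∈ treeDown (.node a hb lb) 𝒜 ↔
      if a ∈ s then
        s ∈ treeDown hb (𝒜.filter fun t => a ∈ t) ∧ s.erase a ∈ treeDown lb (𝒜.filter fun t => a ∉ t)
      else
        s ∈ treeDown lb (𝒜.filter fun t => a ∉ t) ∨ insert a s ∈ treeDown hb (𝒜.filter fun t => a ∈ t) := by
  obtain ⟨-, hhb, hlb⟩ := ht
  have ha : a ∈ insert a F := mem_insert_self a F
  have hA : ∀ u ∈ treeDown hb (𝒜.filter fun t => a ∈ t), a ∈ u :=
    forall_mem_treeDown hhb ha fun u hu => (mem_filter.1 hu).2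
  have hB : ∀ u ∈ treeDown lb (𝒜.filter fun t => a ∉ t), a ∉ u :=
    forall_not_mem_treeDown hlb ha fun u hu => (mem_filter.1 hu).2
  show s ∈ Down.compression a (treeDown hb (𝒜.filter fun t => a ∈ t) ∪
      treeDown lb (𝒜.filter fun t => a ∉ t)) ↔ _
  rw [mem_compression_iff_ite]
  split_ifs with has
  · simp only [mem_union]
    constructor
    · rintro ⟨h1 | h1, h2 | h2⟩
      · exact absurd (hA _ h2) (notMem_erase a s)
      · exact ⟨h1, h2⟩
      · exact absurd has (hB _ h1)
      · exact absurd has (hB _ h1)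
    · rintro ⟨h1, h2⟩
      exact ⟨Or.inl h1, Or.inr h2⟩
  · simp only [mem_union]
    constructor
    · rintro ((h | h) | (h | h))
      · exact absurd (hA _ h) has
      · exact Or.inl h
      · exact Or.inr h
      · exact absurd (mem_insert_self a s) (hB _ h)
    · rintro (h | h)
      · exact Or.inl (Or.inr h)
      · exact Or.inr (Or.inl h)

end Compression

end Summit.CriticalPhenomena.PercolationContinuityZ3.Theorems
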